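/-
Copyright (c) 2026 the pub-hodgecm-mathlib formalisation cell (harness21).  Prover seats hodgecm-mathlib-K2Liu-p09 (g5, g6): Track B «K2-LIT»,
hLiu418 = stmt-HodgeConjecture-24832; LEAD F0P6-plan RULINGS M-156m∕o, M-157a (4)∕c∕m «A7 = GK COCYCLE ROAD», file B7-M2s (split places).
-/
import Summits.HodgeConjecture.HodgeConjecture.Theorems.K2LiuA7NormalisedRegularityMajorant   -- ★ B7-M2 (+ B7-M1, the chain)
import Summits.HodgeConjecture.HodgeConjecture.Theorems.K2LiuRankOneStage                     -- ★ B7-S `integrable_of_letters`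
import Summits.HodgeConjecture.HodgeConjecture.Theorems.K2LiuSiegelSectionNorm                -- ★ B2′ `isLocalSiegelSection_norm`
import HarnessLib

/-!
# Crux `HLiu418`, road `K2_Liu`, organ A7-reg (GK cocycle road), file B7-M2s:
# THE MAJORANT CHAIN AT A SPLIT PLACE — the triple integrand of ★ B4d-3 is integrable on `1 < re s` (two places `w₁ ≠ w₂` above `v`)

Cell `hodgecm-mathlib`, crux item hLiu418 = `stmt-HodgeConjecture-24832`; squad K2 ∕ K2Liu; provers K2Liu-p09 (g5, g6).  THEOREMS ONLY; lane
`--supports stmt-HodgeConjecture-24832` (count-neutral helper).  ONE FRAME (RULING M-156o (c)).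
THE POINT.  ★ B4d-3 `integral_frameConj_weylSiegel_eq_iterated_of_chain` turns `∫_{N_Δ} f(φ(w_Δ^J) u h) du` into the iterated integral `∫_x ∫_z ∫_y` once the three
rank-one integrabilities `hI1`–`hI3` of the MAJORANT `‖f‖` and the measurability `hmeas` are supplied.  For a smooth Siegel section `f ∈ I_v(s, χ_v)` with `χ_v` unitary and
`1 < re s`, `‖f‖` is a Siegel section for `(1, re s)` (★ B2′), so the chain ★ B4d-1b → ★ B7-CB → ★ B7-CC at the datum `(1, re s)` and ★ B7-S `integrable_of_letters` give
`hI1`–`hI3`; `hmeas` is continuity (smooth ⟹ continuous, ★ B7-M1; the letters are continuous, ★ B7-L).  Split place `v` (`w₁ ≠ w₂`); the measure on `E ⊗ F_v` is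
the transport `map e₂ (μ₁ ⊗ μ₂)` along K2Liu-p03 (g6)'s ★ (R3) `e₂ : E_{w₁} × E_{w₂} ≃ₜ E ⊗ F_v`; the middle operator is the composite of the two short-root
stages (★ B7-CB §3 `hrel_short₂`, ★ B7-CC `hrel_long_of_pair`), and the middle integrability is Fubini (`integrable_prod_iff`).
HONEST LABEL.  `HC_CM` is proved only modulo the 7 printed citations (2 remaining named inputs: hLiu418 = `stmt-HodgeConjecture-24832`,
h413 = `stmt-HodgeConjecture-24833`) until rung 0 closes.

## References
* [Casselman1980] W. Casselman, *The unramified principal series of p-adic groups I*, Compositio Math. 40 (1980), §3 Thm. 3.1.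
* [KudlaSweet1997] S. Kudla, W. J. Sweet, Israel J. Math. 98 (1997), §1 (majorant `|f| ∈ I(re s, 1)`).
* [HarrisKudlaSweet1996] M. Harris, S. Kudla, W. J. Sweet, J. AMS 9 (1996), §6 (6.14)–(6.16).
-/

set_option autoImplicit false
set_option linter.dupNamespace false -- the mandated namespace repeats `HodgeConjecture.HodgeConjecture`

noncomputable section

open scoped Classical NNReal ENNReal
open NumberField IsDedekindDomain Matrix MeasureTheory Topology
open Literature.NumberTheory.GaloisRepresentations.IsNonarchimedeanLocalField
open Literature.NumberTheory.Automorphic Literature.NumberTheory.Automorphic.UnitaryGroup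
open Literature.NumberTheory.GelbartRogawski1991.AdaptedBlocks
open Literature.NumberTheory.GelbartRogawski1991.UnitaryDualPair.LocalSplitting
open Literature.NumberTheory.K2Lit.LocalSiegelDoubled
open Summit.HodgeConjecture.HodgeConjecture.Cruxes.HLiu418.K2LiuLocalLFactorDefs
open Summit.HodgeConjecture.HodgeConjecture.Cruxes.HLiu418.K2LiuQRationalLFactor
open Summit.HodgeConjecture.HodgeConjecture.Cruxes.HLiu418.K2LiuLocalSiegelIwasawaFrame
open Summit.HodgeConjecture.HodgeConjecture.Cruxes.HLiu418.K2LiuLocalSiegelIwasawa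
open Summit.HodgeConjecture.HodgeConjecture.Cruxes.HLiu418.K2LiuDoubledUTwoTwoBorelFrame
open Summit.HodgeConjecture.HodgeConjecture.Cruxes.HLiu418.K2LiuDoubledUTwoTwoWeylCocycle
open Summit.HodgeConjecture.HodgeConjecture.Cruxes.HLiu418.K2LiuDoubledUTwoTwoLevi
open Summit.HodgeConjecture.HodgeConjecture.Cruxes.HLiu418.K2LiuDoubledUTwoTwoFrameTransport
open Summit.HodgeConjecture.HodgeConjecture.Cruxes.HLiu418.K2LiuUnipDeltaRankOneCoordinates
open Summit.HodgeConjecture.HodgeConjecture.Cruxes.HLiu418.K2LiuSiegelCocycleLetters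
open Summit.HodgeConjecture.HodgeConjecture.Cruxes.HLiu418.K2LiuSiegelCocycleStageLetters
open Summit.HodgeConjecture.HodgeConjecture.Cruxes.HLiu418.K2LiuSiegelCocycleStageShort
open Summit.HodgeConjecture.HodgeConjecture.Cruxes.HLiu418.K2LiuSiegelCocycleChainShort
open Summit.HodgeConjecture.HodgeConjecture.Cruxes.HLiu418.K2LiuSiegelCocycleChainLong
open Summit.HodgeConjecture.HodgeConjecture.Cruxes.HLiu418.K2LiuSiegelSectionNorm
open Summit.HodgeConjecture.HodgeConjecture.Cruxes.HLiu418.K2LiuRankOneStage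
open Summit.HodgeConjecture.HodgeConjecture.Cruxes.HLiu418.K2LiuA7NormalisedRegularitySetup

namespace Summit.HodgeConjecture.HodgeConjecture.Cruxes.HLiu418.K2LiuA7NormalisedRegularityMajorantSplit

/-- `re (TA g) = ∫ ‖f₀ (B x g)‖` when `Fa = (‖f₀‖ : ℂ)` and `TA = ∫ Fa (B · g)`: the `re`∕`ofReal` bookkeeping of the majorant tower, stated ONCE over an
abstract letter `B` so that the tower's words are never re-elaborated (bookkeeping for ★ B7-M2's Fubini step). [folklore] -/
theorem re_apply_eq_integral_norm {X G : Type*} [MeasurableSpace X] (μ : Measure X) {f₀ Fa TA : G → ℂ} {B : X → G → G}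
    (hFa : Fa = fun g => ((‖f₀ g‖ : ℝ) : ℂ)) (hTA : TA = fun g => ∫ x, Fa (B x g) ∂μ) (g : G) :
    RCLike.re (TA g) = ∫ x, ‖f₀ (B x g)‖ ∂μ := by
  subst hFa hTA
  show RCLike.re (∫ x, ((‖f₀ (B x g)‖ : ℝ) : ℂ) ∂μ) = ∫ x, ‖f₀ (B x g)‖ ∂μ
  rw [integral_complex_ofReal]; rfl

variable (F : Type) [Field F] [NumberField F] (E : Type) [Field E] [NumberField E] [Algebra F E]
  [Algebra.IsQuadraticExtension F E] (c : E ≃ₐ[F] E)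
  {δ : E} (hcδ : c δ = -δ) (hδ : δ ≠ 0) {d : F} (hd : δ * δ = algebraMap F E d) (v : HeightOneSpectrum (𝓞 F))
  {T₂ : Matrix (Fin 2) (Fin 2) F} (hT₂ : T₂.IsSymm) {J₂D : Matrix (Fin (2 + 2)) (Fin (2 + 2)) E} (hJ₂D : J₂D = (gramD F 2 T₂).map (algebraMap F E))
  (D Dinv : Matrix (Fin 2) (Fin 2) F) (hDD : D * Dinv = 1) (Q : GL (Fin (2 + 2)) F)
  (hQm : (Q : Matrix (Fin (2 + 2)) (Fin (2 + 2)) F) = Matrix.reindex (e₂ 2) (e₂ 2) (Matrix.fromBlocks 1 D 1 (-D)))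
  (hQ : (Q : Matrix (Fin (2 + 2)) (Fin (2 + 2)) F)ᵀ * gramD F 2 T₂ * (Q : Matrix (Fin (2 + 2)) (Fin (2 + 2)) F) = (StdForm.antidiagonal (2 + 2)).over F)
  [MeasurableSpace (v.adicCompletion F)] [BorelSpace (v.adicCompletion F)] [SecondCountableTopology (v.adicCompletion F)]
  [MeasurableSpace (UnitaryGroup.LocalRing E v)] [BorelSpace (UnitaryGroup.LocalRing E v)] [SecondCountableTopology (UnitaryGroup.LocalRing E v)]
  (μF : Measure (v.adicCompletion F)) [μF.IsAddHaarMeasure]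
  (e : (v.adicCompletion F × UnitaryGroup.LocalRing E v × v.adicCompletion F) ≃ₜ unipDeltaLocal F E c v 2 (JD := J₂D))
  (he : ∀ b₁ z b₂, ((e (b₁, z, b₂) : unipDeltaLocal F E c v 2 (JD := J₂D)) : UnitaryGroup.localPi E c (2 + 2) J₂D v) =
      FrameTransport.frameConj F E c v (2 + 2) hJ₂D (antidiagonal_over_eq_map F E 2) Q hQ (toLocalFour F E c v (nSiegel (UnitaryGroup.LocalRing E v) (UnitaryGroup.conjLocal E c v) (UnitaryGroup.conjLocal_conjLocal c v hcδ hδ) (UnitaryGroup.toLocalRing E v b₁ * algebraMap E (UnitaryGroup.LocalRing E v) δ) z (UnitaryGroup.toLocalRing E v b₂ * algebraMap E (UnitaryGroup.LocalRing E v) δ) (conjLocal_coord F E c hcδ v b₁) (conjLocal_coord F E c hcδ v b₂))))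
  {χv : ∀ w : PlacesOver E v, (w.1.adicCompletion E)ˣ →* ℂˣ} (hχ : ∀ (w' : PlacesOver E v) (x : (w'.1.adicCompletion E)ˣ), ‖((χv w' x : ℂˣ) : ℂ)‖ = 1)
  {s : ℂ} (hs : 1 < s.re) {f₀ : UnitaryGroup.localPi E c (2 + 2) J₂D v → ℂ} (hf₀ : IsLocalSiegelSection F E c hcδ hδ hd v 2 hT₂ hJ₂D χv s f₀) (hsm₀ : IsSmooth F E c v 2 f₀)
  (K' : OpenSubgroup (UnitaryGroup.localPi E c (2 + 2) J₂D v)) (hK' : ∀ g, ∀ k ∈ (K' : Subgroup (UnitaryGroup.localPi E c (2 + 2) J₂D v)), f₀ (g * k) = f₀ g)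
  (w₁ w₂ : PlacesOver E v) (hne : w₁ ≠ w₂) (hw : ∀ w' : PlacesOver E v, w' = w₁ ∨ w' = w₂)
  [MeasurableSpace (w₁.1.adicCompletion E)] [BorelSpace (w₁.1.adicCompletion E)] [SecondCountableTopology (w₁.1.adicCompletion E)]
  (μ₁ : Measure (w₁.1.adicCompletion E)) [μ₁.IsAddHaarMeasure]
  [MeasurableSpace (w₂.1.adicCompletion E)] [BorelSpace (w₂.1.adicCompletion E)] [SecondCountableTopology (w₂.1.adicCompletion E)]
  (μ₂ : Measure (w₂.1.adicCompletion E)) [μ₂.IsAddHaarMeasure]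
  (e₂ : (w₁.1.adicCompletion E × w₂.1.adicCompletion E) ≃ₜ UnitaryGroup.LocalRing E v) (he₂ : ∀ ζ₁ ζ₂, e₂ (ζ₁, ζ₂) = Pi.single w₁ ζ₁ + Pi.single w₂ ζ₂)
  (A₁ : GL (Fin 2) (UnitaryGroup.LocalRing E v)) (hA₁ : A₁.val = !![1 - Pi.single w₁ 1, Pi.single w₁ 1; Pi.single w₁ 1, 1 - Pi.single w₁ 1])
  (A₂ : GL (Fin 2) (UnitaryGroup.LocalRing E v)) (hA₂ : A₂.val = !![1 - Pi.single w₂ 1, Pi.single w₂ 1; Pi.single w₂ 1, 1 - Pi.single w₂ 1])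

set_option maxHeartbeats 400000 in -- measured 2026-09-04: the four-stage majorant tower at a split place (two short `integrable_of_letters` stages + Fubini) needs > 200 000; 400 000 passes; no search tactics
include hcδ hδ hd hT₂ hDD hQm he hχ hs hf₀ hsm₀ hK' hne hw he₂ hA₁ hA₂ in
/-- **THE MAJORANT CHAIN (split place).**  As ★ B7-M2 `chain_integrability_of_forall_eq`, at a place `v` with two places `w₁ ≠ w₂` of `E` above it; the measure on
`E ⊗ F_v` is `map e₂ (μ₁ ⊗ μ₂)` and the middle integrability is Fubini over the two short-root stages. [cite: KudlaSweet1997, §1] [cite: Casselman1980, §3 Thm. 3.1] -/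
theorem chain_integrability_of_pair (h : UnitaryGroup.localPi E c (2 + 2) J₂D v) :
    AEStronglyMeasurable (fun p : v.adicCompletion F × (UnitaryGroup.LocalRing E v × v.adicCompletion F) =>
        f₀ (FrameTransport.frameConj F E c v (2 + 2) hJ₂D (antidiagonal_over_eq_map F E 2) Q hQ (toLocalFour F E c v (weylTwo (UnitaryGroup.LocalRing E v) (UnitaryGroup.conjLocal E c v))) * FrameTransport.frameConj F E c v (2 + 2) hJ₂D (antidiagonal_over_eq_map F E 2) Q hQ (toLocalFour F E c v (uLongTwo (UnitaryGroup.LocalRing E v) (UnitaryGroup.conjLocal E c v) (UnitaryGroup.toLocalRing E v p.2.2 * algebraMap E (UnitaryGroup.LocalRing E v) δ) (conjLocal_coord F E c hcδ v p.2.2))) *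
          (FrameTransport.frameConj F E c v (2 + 2) hJ₂D (antidiagonal_over_eq_map F E 2) Q hQ (toLocalFour F E c v (weylOne (UnitaryGroup.LocalRing E v) (UnitaryGroup.conjLocal E c v))) * FrameTransport.frameConj F E c v (2 + 2) hJ₂D (antidiagonal_over_eq_map F E 2) Q hQ (toLocalFour F E c v (uMinus (UnitaryGroup.LocalRing E v) (UnitaryGroup.conjLocal E c v) (UnitaryGroup.conjLocal_conjLocal c v hcδ hδ) p.2.1)) *
            (FrameTransport.frameConj F E c v (2 + 2) hJ₂D (antidiagonal_over_eq_map F E 2) Q hQ (toLocalFour F E c v (weylTwo (UnitaryGroup.LocalRing E v) (UnitaryGroup.conjLocal E c v))) * FrameTransport.frameConj F E c v (2 + 2) hJ₂D (antidiagonal_over_eq_map F E 2) Q hQ (toLocalFour F E c v (uLongTwo (UnitaryGroup.LocalRing E v) (UnitaryGroup.conjLocal E c v) (UnitaryGroup.toLocalRing E v p.1 * algebraMap E (UnitaryGroup.LocalRing E v) δ) (conjLocal_coord F E c hcδ v p.1))) * h)))) (μF.prod ((Measure.map e₂ (μ₁.prod μ₂)).prod μF)) ∧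
      (∀ g : UnitaryGroup.localPi E c (2 + 2) J₂D v, Integrable (fun y : v.adicCompletion F => ‖f₀ (FrameTransport.frameConj F E c v (2 + 2) hJ₂D (antidiagonal_over_eq_map F E 2) Q hQ (toLocalFour F E c v (weylTwo (UnitaryGroup.LocalRing E v) (UnitaryGroup.conjLocal E c v))) * FrameTransport.frameConj F E c v (2 + 2) hJ₂D (antidiagonal_over_eq_map F E 2) Q hQ (toLocalFour F E c v (uLongTwo (UnitaryGroup.LocalRing E v) (UnitaryGroup.conjLocal E c v) (UnitaryGroup.toLocalRing E v y * algebraMap E (UnitaryGroup.LocalRing E v) δ) (conjLocal_coord F E c hcδ v y))) * g)‖) μF) ∧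
      (∀ g' : UnitaryGroup.localPi E c (2 + 2) J₂D v, Integrable (fun z : UnitaryGroup.LocalRing E v =>
        ∫ y, ‖f₀ (FrameTransport.frameConj F E c v (2 + 2) hJ₂D (antidiagonal_over_eq_map F E 2) Q hQ (toLocalFour F E c v (weylTwo (UnitaryGroup.LocalRing E v) (UnitaryGroup.conjLocal E c v))) * FrameTransport.frameConj F E c v (2 + 2) hJ₂D (antidiagonal_over_eq_map F E 2) Q hQ (toLocalFour F E c v (uLongTwo (UnitaryGroup.LocalRing E v) (UnitaryGroup.conjLocal E c v) (UnitaryGroup.toLocalRing E v y * algebraMap E (UnitaryGroup.LocalRing E v) δ) (conjLocal_coord F E c hcδ v y))) *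
          (FrameTransport.frameConj F E c v (2 + 2) hJ₂D (antidiagonal_over_eq_map F E 2) Q hQ (toLocalFour F E c v (weylOne (UnitaryGroup.LocalRing E v) (UnitaryGroup.conjLocal E c v))) * FrameTransport.frameConj F E c v (2 + 2) hJ₂D (antidiagonal_over_eq_map F E 2) Q hQ (toLocalFour F E c v (uMinus (UnitaryGroup.LocalRing E v) (UnitaryGroup.conjLocal E c v) (UnitaryGroup.conjLocal_conjLocal c v hcδ hδ) z)) * g'))‖ ∂μF) (Measure.map e₂ (μ₁.prod μ₂))) ∧
      Integrable (fun x : v.adicCompletion F => ∫ z, ∫ y, ‖f₀ (FrameTransport.frameConj F E c v (2 + 2) hJ₂D (antidiagonal_over_eq_map F E 2) Q hQ (toLocalFour F E c v (weylTwo (UnitaryGroup.LocalRing E v) (UnitaryGroup.conjLocal E c v))) * FrameTransport.frameConj F E c v (2 + 2) hJ₂D (antidiagonal_over_eq_map F E 2) Q hQ (toLocalFour F E c v (uLongTwo (UnitaryGroup.LocalRing E v) (UnitaryGroup.conjLocal E c v) (UnitaryGroup.toLocalRing E v y * algebraMap E (UnitaryGroup.LocalRing E v) δ) (conjLocal_coord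 F E c hcδ v y))) *
          (FrameTransport.frameConj F E c v (2 + 2) hJ₂D (antidiagonal_over_eq_map F E 2) Q hQ (toLocalFour F E c v (weylOne (UnitaryGroup.LocalRing E v) (UnitaryGroup.conjLocal E c v))) * FrameTransport.frameConj F E c v (2 + 2) hJ₂D (antidiagonal_over_eq_map F E 2) Q hQ (toLocalFour F E c v (uMinus (UnitaryGroup.LocalRing E v) (UnitaryGroup.conjLocal E c v) (UnitaryGroup.conjLocal_conjLocal c v hcδ hδ) z)) *
            (FrameTransport.frameConj F E c v (2 + 2) hJ₂D (antidiagonal_over_eq_map F E 2) Q hQ (toLocalFour F E c v (weylTwo (UnitaryGroup.LocalRing E v) (UnitaryGroup.conjLocal E c v))) * FrameTransport.frameConj F E c v (2 + 2) hJ₂D (antidiagonal_over_eq_map F E 2) Q hQ (toLocalFour F E c v (uLongTwo (UnitaryGroup.LocalRing E v) (UnitaryGroup.conjLocal E c v) (UnitaryGroup.toLocalRing E v x * algebraMap E (UnitaryGroup.LocalRing E v) δ) (conjLocal_coord F E c hcδ v x))) * h)))‖ ∂μF ∂(Measure.map e₂ (μ₁.prod μ₂))) μF := by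
  -- the majorant `‖f‖ ∈ I_v(re s, 1)` and its tower `TA`, `TB₂ = ℬ_{w₂} TA`, `TB = ℬ_{w₁} TB₂`
  obtain ⟨χ1, hχ1def⟩ : ∃ χ1 : ∀ w' : PlacesOver E v, (w'.1.adicCompletion E)ˣ →* ℂˣ, χ1 = fun w' => 1 := ⟨_, rfl⟩
  have hχ1 : ∀ (w' : PlacesOver E v) (x : (w'.1.adicCompletion E)ˣ), ‖((χ1 w' x : ℂˣ) : ℂ)‖ = 1 := fun w' x => by simp [hχ1def]
  obtain ⟨Fa, hFa⟩ : ∃ Fa : UnitaryGroup.localPi E c (2 + 2) J₂D v → ℂ, Fa = fun g => ((‖f₀ g‖ : ℝ) : ℂ) := ⟨_, rfl⟩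
  have hFaS : IsLocalSiegelSection F E c hcδ hδ hd v 2 hT₂ hJ₂D χ1 (s.re : ℂ) Fa := by
    rw [hFa, hχ1def]; exact isLocalSiegelSection_norm F E c hcδ hδ hd v 2 hT₂ hJ₂D hχ hf₀
  have hFaK : ∀ g, ∀ k ∈ (K' : Subgroup (UnitaryGroup.localPi E c (2 + 2) J₂D v)), Fa (g * k) = Fa g := fun g k hk => by simp only [hFa, hK' g k hk]
  obtain ⟨TA, hTA⟩ : ∃ TA : UnitaryGroup.localPi E c (2 + 2) J₂D v → ℂ, TA = fun g => ∫ y, Fa (FrameTransport.frameConj F E c v (2 + 2) hJ₂D (antidiagonal_over_eq_map F E 2) Q hQ (toLocalFour F E c v (weylTwo (UnitaryGroup.LocalRing E v) (UnitaryGroup.conjLocal E c v))) * FrameTransport.frameConj F E c v (2 + 2) hJ₂D (antidiagonal_over_eq_map F E 2) Q hQ (toLocalFour F E c v (uLongTwo (UnitaryGroup.LocalRing E v) (UnitaryGroup.conjLocal E c v) (UnitaryGroup.toLocalRing E v y * algebraMap E (UnitaryGroup.LocalRing E v) δ) (conjLocal_coord F E c hcδ v y))) * g) ∂μF := ⟨_,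 rfl⟩
  have hTAK : ∀ g, ∀ k ∈ (K' : Subgroup (UnitaryGroup.localPi E c (2 + 2) J₂D v)), TA (g * k) = TA g := fun g k hk => by
    rw [hTA]; exact integral_congr_ae (Filter.Eventually.of_forall fun y => by simp only [← mul_assoc]; exact hFaK _ k hk)
  have hTA1 : ∀ g, TA g = 1 * ∫ y, Fa (FrameTransport.frameConj F E c v (2 + 2) hJ₂D (antidiagonal_over_eq_map F E 2) Q hQ (toLocalFour F E c v (weylTwo (UnitaryGroup.LocalRing E v) (UnitaryGroup.conjLocal E c v))) * FrameTransport.frameConj F E c v (2 + 2) hJ₂D (antidiagonal_over_eq_map F E 2) Q hQ (toLocalFour F E c v (uLongTwo (UnitaryGroup.LocalRing E v) (UnitaryGroup.conjLocal E c v) (UnitaryGroup.toLocalRing E v y * algebraMap E (UnitaryGroup.LocalRing E v) δ) (conjLocal_coord F E c hcδ v y))) * g) ∂μF := fun g => by rw [hTA, one_mul]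
  obtain ⟨TB₂, hTB₂⟩ : ∃ TB₂ : UnitaryGroup.localPi E c (2 + 2) J₂D v → ℂ, TB₂ = fun g => ∫ ζ, TA (FrameTransport.frameConj F E c v (2 + 2) hJ₂D (antidiagonal_over_eq_map F E 2) Q hQ (toLocalFour F E c v (leviElt (UnitaryGroup.LocalRing E v) (UnitaryGroup.conjLocal E c v) (UnitaryGroup.conjLocal_conjLocal c v hcδ hδ) A₂)) * FrameTransport.frameConj F E c v (2 + 2) hJ₂D (antidiagonal_over_eq_map F E 2) Q hQ (toLocalFour F E c v (uMinus (UnitaryGroup.LocalRing E v) (UnitaryGroup.conjLocal E c v) (UnitaryGroup.conjLocal_conjLocal c v hcδ hδ) (Pi.single w₂ ζ))) * g) ∂μ₂ := ⟨_, rfl⟩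
  have hTB₂K : ∀ g, ∀ k ∈ (K' : Subgroup (UnitaryGroup.localPi E c (2 + 2) J₂D v)), TB₂ (g * k) = TB₂ g := fun g k hk => by
    rw [hTB₂]; exact integral_congr_ae (Filter.Eventually.of_forall fun ζ => by simp only [← mul_assoc]; exact hTAK _ k hk)
  have hTB₂1 : ∀ g, TB₂ g = 1 * ∫ ζ, TA (FrameTransport.frameConj F E c v (2 + 2) hJ₂D (antidiagonal_over_eq_map F E 2) Q hQ (toLocalFour F E c v (leviElt (UnitaryGroup.LocalRing E v) (UnitaryGroup.conjLocal E c v) (UnitaryGroup.conjLocal_conjLocal c v hcδ hδ) A₂)) * FrameTransport.frameConj F E c v (2 + 2) hJ₂D (antidiagonal_over_eq_map F E 2) Q hQ (toLocalFour F E c v (uMinus (UnitaryGroup.LocalRing E v) (UnitaryGroup.conjLocal E c v) (UnitaryGroup.conjLocal_conjLocal c v hcδ hδ) (Pi.single w₂ ζ))) * g) ∂μ₂ := fun g => by rw [hTB₂, one_mul]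
  obtain ⟨TB, hTB⟩ : ∃ TB : UnitaryGroup.localPi E c (2 + 2) J₂D v → ℂ, TB = fun g => ∫ ζ, TB₂ (FrameTransport.frameConj F E c v (2 + 2) hJ₂D (antidiagonal_over_eq_map F E 2) Q hQ (toLocalFour F E c v (leviElt (UnitaryGroup.LocalRing E v) (UnitaryGroup.conjLocal E c v) (UnitaryGroup.conjLocal_conjLocal c v hcδ hδ) A₁)) * FrameTransport.frameConj F E c v (2 + 2) hJ₂D (antidiagonal_over_eq_map F E 2) Q hQ (toLocalFour F E c v (uMinus (UnitaryGroup.LocalRing E v) (UnitaryGroup.conjLocal E c v) (UnitaryGroup.conjLocal_conjLocal c v hcδ hδ) (Pi.single w₁ ζ))) * g) ∂μ₁ := ⟨_, rfl⟩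
  have hTBK : ∀ g, ∀ k ∈ (K' : Subgroup (UnitaryGroup.localPi E c (2 + 2) J₂D v)), TB (g * k) = TB g := fun g k hk => by
    rw [hTB]; exact integral_congr_ae (Filter.Eventually.of_forall fun ζ => by simp only [← mul_assoc]; exact hTB₂K _ k hk)
  have hTB1 : ∀ g, TB g = 1 * ∫ ζ, TB₂ (FrameTransport.frameConj F E c v (2 + 2) hJ₂D (antidiagonal_over_eq_map F E 2) Q hQ (toLocalFour F E c v (leviElt (UnitaryGroup.LocalRing E v) (UnitaryGroup.conjLocal E c v) (UnitaryGroup.conjLocal_conjLocal c v hcδ hδ) A₁)) * FrameTransport.frameConj F E c v (2 + 2) hJ₂D (antidiagonal_over_eq_map F E 2) Q hQ (toLocalFour F E c v (uMinus (UnitaryGroup.LocalRing E v) (UnitaryGroup.conjLocal E c v) (UnitaryGroup.conjLocal_conjLocal c v hcδ hδ) (Pi.single w₁ ζ))) * g) ∂μ₁ := fun g => by rw [hTB, one_mul]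
  -- letters
  have huA := continuous_frameConj_uLongTwo_coord F E c hcδ hδ v hJ₂D Q hQ e he
  have hūA := continuous_ubar F E c hcδ hδ hd v hJ₂D Q hQ e he
  have huB1 := continuous_frameConj_uMinus_single F E c hcδ hδ v hJ₂D Q hQ w₁ e he
  have hūB1 := continuous_ubar_single F E c hcδ hδ v hJ₂D Q hQ w₁ e he (single_one_mul_single_one F E v w₁) A₁ hA₁
  have huB2 := continuous_frameConj_uMinus_single F E c hcδ hδ v hJ₂D Q hQ w₂ e he
  have hūB2 := continuous_ubar_single F E c hcδ hδ v hJ₂D Q hQ w₂ e he (single_one_mul_single_one F E v w₂) A₂ hA₂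
  have huB1add : ∀ ζ ζ' : w₁.1.adicCompletion E, FrameTransport.frameConj F E c v (2 + 2) hJ₂D (antidiagonal_over_eq_map F E 2) Q hQ (toLocalFour F E c v (uMinus (UnitaryGroup.LocalRing E v) (UnitaryGroup.conjLocal E c v) (UnitaryGroup.conjLocal_conjLocal c v hcδ hδ) (Pi.single w₁ (ζ + ζ')))) = FrameTransport.frameConj F E c v (2 + 2) hJ₂D (antidiagonal_over_eq_map F E 2) Q hQ (toLocalFour F E c v (uMinus (UnitaryGroup.LocalRing E v) (UnitaryGroup.conjLocal E c v) (UnitaryGroup.conjLocal_conjLocal c v hcδ hδ) (Pi.single w₁ ζ))) * FrameTransport.frameConj F E c v (2 + 2) hJ₂D (antidiagonal_over_eq_map F E 2) Q hQ (toLocalFour F E c v (uMinus (UnitaryGroup.LocalRing E v) (UnitaryGroup.conjLocal E c v) (UnitaryGroup.conjLocal_conjLocal c v hcδ hδ) (Pi.single w₁ ζ'))) :=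
    fun ζ ζ' => by
      rw [show uMinus (UnitaryGroup.LocalRing E v) (UnitaryGroup.conjLocal E c v) (UnitaryGroup.conjLocal_conjLocal c v hcδ hδ) (Pi.single w₁ (ζ + ζ')) =
          uMinus (UnitaryGroup.LocalRing E v) (UnitaryGroup.conjLocal E c v) (UnitaryGroup.conjLocal_conjLocal c v hcδ hδ) (Pi.single w₁ ζ) * uMinus (UnitaryGroup.LocalRing E v) (UnitaryGroup.conjLocal E c v) (UnitaryGroup.conjLocal_conjLocal c v hcδ hδ) (Pi.single w₁ ζ') by
        rw [uMinus_mul, ← Pi.single_add], map_mul, map_mul]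
  have huB2add : ∀ ζ ζ' : w₂.1.adicCompletion E, FrameTransport.frameConj F E c v (2 + 2) hJ₂D (antidiagonal_over_eq_map F E 2) Q hQ (toLocalFour F E c v (uMinus (UnitaryGroup.LocalRing E v) (UnitaryGroup.conjLocal E c v) (UnitaryGroup.conjLocal_conjLocal c v hcδ hδ) (Pi.single w₂ (ζ + ζ')))) = FrameTransport.frameConj F E c v (2 + 2) hJ₂D (antidiagonal_over_eq_map F E 2) Q hQ (toLocalFour F E c v (uMinus (UnitaryGroup.LocalRing E v) (UnitaryGroup.conjLocal E c v) (UnitaryGroup.conjLocal_conjLocal c v hcδ hδ) (Pi.single w₂ ζ))) * FrameTransport.frameConj F E c v (2 + 2) hJ₂D (antidiagonal_over_eq_map F E 2) Q hQ (toLocalFour F E c v (uMinus (UnitaryGroup.LocalRing E v) (UnitaryGroup.conjLocal E c v) (UnitaryGroup.conjLocal_conjLocal c v hcδ hδ) (Pi.single w₂ ζ'))) :=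
    fun ζ ζ' => by
      rw [show uMinus (UnitaryGroup.LocalRing E v) (UnitaryGroup.conjLocal E c v) (UnitaryGroup.conjLocal_conjLocal c v hcδ hδ) (Pi.single w₂ (ζ + ζ')) =
          uMinus (UnitaryGroup.LocalRing E v) (UnitaryGroup.conjLocal E c v) (UnitaryGroup.conjLocal_conjLocal c v hcδ hδ) (Pi.single w₂ ζ) * uMinus (UnitaryGroup.LocalRing E v) (UnitaryGroup.conjLocal E c v) (UnitaryGroup.conjLocal_conjLocal c v hcδ hδ) (Pi.single w₂ ζ') by
        rw [uMinus_mul, ← Pi.single_add], map_mul, map_mul]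
  -- stage A on `‖f‖`
  have heA : 1 < (2 * (s.re : ℂ) + 2).re := by simp; linarith
  have hIA : ∀ g, Integrable (fun y => Fa (FrameTransport.frameConj F E c v (2 + 2) hJ₂D (antidiagonal_over_eq_map F E 2) Q hQ (toLocalFour F E c v (weylTwo (UnitaryGroup.LocalRing E v) (UnitaryGroup.conjLocal E c v))) * FrameTransport.frameConj F E c v (2 + 2) hJ₂D (antidiagonal_over_eq_map F E 2) Q hQ (toLocalFour F E c v (uLongTwo (UnitaryGroup.LocalRing E v) (UnitaryGroup.conjLocal E c v) (UnitaryGroup.toLocalRing E v y * algebraMap E (UnitaryGroup.LocalRing E v) δ) (conjLocal_coord F E c hcδ v y))) * g)) μF := fun g =>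
    integrable_of_letters μF K'.isOpen hFaK huA (frameConj_uLongTwo_coord_zero F E c hcδ v hJ₂D Q hQ) hūA (ubar_zero F E c hcδ hδ hd v hJ₂D Q hQ)
      (frameConj_uLongTwo_coord_add F E c hcδ v hJ₂D Q hQ) _ (chiF F E v χ1) (norm_chiF_eq_one (F := F) (E := E) hχ1) _ _ heA
      (apply_weylTwo_uLongTwo_coord_of_isLocalSiegelSection F E c hcδ hδ hd v hT₂ hJ₂D D Dinv hDD Q hQm hQ χ1 _ hFaS) g
  -- stage B₂ on `TA`, stage B₁ on `TB₂`
  have heB : 1 < (2 * (s.re : ℂ) + 1).re := by simp; linarith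
  have hIB2 : ∀ g, Integrable (fun ζ => TA (FrameTransport.frameConj F E c v (2 + 2) hJ₂D (antidiagonal_over_eq_map F E 2) Q hQ (toLocalFour F E c v (leviElt (UnitaryGroup.LocalRing E v) (UnitaryGroup.conjLocal E c v) (UnitaryGroup.conjLocal_conjLocal c v hcδ hδ) A₂)) * FrameTransport.frameConj F E c v (2 + 2) hJ₂D (antidiagonal_over_eq_map F E 2) Q hQ (toLocalFour F E c v (uMinus (UnitaryGroup.LocalRing E v) (UnitaryGroup.conjLocal E c v) (UnitaryGroup.conjLocal_conjLocal c v hcδ hδ) (Pi.single w₂ ζ))) * g)) μ₂ := fun g =>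
    integrable_of_letters μ₂ K'.isOpen hTAK huB2.1 huB2.2 hūB2.1 hūB2.2 huB2add _ (chiNorm F E c v χ1 w₂) (norm_chiNorm_eq_one (F := F) (E := E) (c := c) hχ1 w₂) _ _ heB
      (hrel_short F E c hcδ hδ hd v hT₂ hJ₂D D Dinv hDD Q hQm hQ μF χ1 _ hFaS 1 hTA1 w₂ A₂ hA₂) g
  have hIB1 : ∀ g, Integrable (fun ζ => TB₂ (FrameTransport.frameConj F E c v (2 + 2) hJ₂D (antidiagonal_over_eq_map F E 2) Q hQ (toLocalFour F E c v (leviElt (UnitaryGroup.LocalRing E v) (UnitaryGroup.conjLocal E c v) (UnitaryGroup.conjLocal_conjLocal c v hcδ hδ) A₁)) * FrameTransport.frameConj F E c v (2 + 2) hJ₂D (antidiagonal_over_eq_map F E 2) Q hQ (toLocalFour F E c v (uMinus (UnitaryGroup.LocalRing E v) (UnitaryGroup.conjLocal E c v) (UnitaryGroup.conjLocal_conjLocal c v hcδ hδ) (Pi.single w₁ ζ))) * g)) μ₁ := fun g =>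
    integrable_of_letters μ₁ K'.isOpen hTB₂K huB1.1 huB1.2 hūB1.1 hūB1.2 huB1add _ (chiNorm F E c v χ1 w₁) (norm_chiNorm_eq_one (F := F) (E := E) (c := c) hχ1 w₁) _ _ heB
      (hrel_short₂ F E c hcδ hδ hd v hT₂ hJ₂D D Dinv hDD Q hQm hQ μF χ1 _ hFaS 1 hTA1 w₂ μ₂ A₂ hA₂ 1 hTB₂1 w₁ hne A₁ hA₁) g
  -- stage C on `TB`
  have heC : 1 < (2 * (s.re : ℂ)).re := by simp; linarith
  have hIC : ∀ g, Integrable (fun x => TB (FrameTransport.frameConj F E c v (2 + 2) hJ₂D (antidiagonal_over_eq_map F E 2) Q hQ (toLocalFour F E c v (weylTwo (UnitaryGroup.LocalRing E v) (UnitaryGroup.conjLocal E c v))) * FrameTransport.frameConj F E c v (2 + 2) hJ₂D (antidiagonal_over_eq_map F E 2) Q hQ (toLocalFour F E c v (uLongTwo (UnitaryGroup.LocalRing E v) (UnitaryGroup.conjLocal E c v) (UnitaryGroup.toLocalRing E v x * algebraMap E (UnitaryGroup.LocalRing E v) δ) (conjLocal_coord F E c hcδ v x))) * g)) μF := fun g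 =>
    integrable_of_letters μF K'.isOpen hTBK huA (frameConj_uLongTwo_coord_zero F E c hcδ v hJ₂D Q hQ) hūA (ubar_zero F E c hcδ hδ hd v hJ₂D Q hQ)
      (frameConj_uLongTwo_coord_add F E c hcδ v hJ₂D Q hQ) _ (chiF F E v χ1) (norm_chiF_eq_one (F := F) (E := E) hχ1) _
      (localSiegelCharacter F E c v 2 χ1 (s.re : ℂ) (FrameTransport.frameConj F E c v (2 + 2) hJ₂D (antidiagonal_over_eq_map F E 2) Q hQ (toLocalFour F E c v (torusElt (UnitaryGroup.LocalRing E v) (UnitaryGroup.conjLocal E c v) (UnitaryGroup.conjLocal_conjLocal c v hcδ hδ) (-((Units.mk0 δ hδ).map (algebraMap E (UnitaryGroup.LocalRing E v) : E →* UnitaryGroup.LocalRing E v))⁻¹) 1))) * ((∏ w' : PlacesOver E v, ‖algebraMap E (UnitaryGroup.LocalRing E v) δ w'‖ : ℝ) : ℂ)) heC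
      (fun x g => by
        rw [hrel_long_of_pair F E c hcδ hδ hd v hT₂ hJ₂D D Dinv hDD Q hQm hQ μF χ1 _ hFaS 1 hTA1 w₁ w₂ hne hw μ₂ A₂ hA₂ 1 hTB₂1 μ₁ A₁ hA₁ 1 hTB1 x g]; ring) g
  -- the middle word through the two places (second place innermost)
  have hw' : ∀ w' : PlacesOver E v, w' = w₂ ∨ w' = w₁ := fun w' => (hw w').symm
  have hmid : ∀ (ζ₁ : w₁.1.adicCompletion E) (ζ₂ : w₂.1.adicCompletion E) (g : UnitaryGroup.localPi E c (2 + 2) J₂D v),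
      FrameTransport.frameConj F E c v (2 + 2) hJ₂D (antidiagonal_over_eq_map F E 2) Q hQ (toLocalFour F E c v (weylOne (UnitaryGroup.LocalRing E v) (UnitaryGroup.conjLocal E c v))) * FrameTransport.frameConj F E c v (2 + 2) hJ₂D (antidiagonal_over_eq_map F E 2) Q hQ (toLocalFour F E c v (uMinus (UnitaryGroup.LocalRing E v) (UnitaryGroup.conjLocal E c v) (UnitaryGroup.conjLocal_conjLocal c v hcδ hδ) (Pi.single w₁ ζ₁ + Pi.single w₂ ζ₂))) * g =
        FrameTransport.frameConj F E c v (2 + 2) hJ₂D (antidiagonal_over_eq_map F E 2) Q hQ (toLocalFour F E c v (leviElt (UnitaryGroup.LocalRing E v) (UnitaryGroup.conjLocal E c v) (UnitaryGroup.conjLocal_conjLocal c v hcδ hδ) A₂)) * FrameTransport.frameConj F E c v (2 + 2) hJ₂D (antidiagonal_over_eq_map F E 2) Q hQ (toLocalFour F E c v (uMinus (UnitaryGroup.LocalRing E v) (UnitaryGroup.conjLocal E c v) (UnitaryGroup.conjLocal_conjLocal c v hcδ hδ) (Pi.single w₂ ζ₂))) * (FrameTransport.frameConj F E c v (2 + 2)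 hJ₂D (antidiagonal_over_eq_map F E 2) Q hQ (toLocalFour F E c v (leviElt (UnitaryGroup.LocalRing E v) (UnitaryGroup.conjLocal E c v) (UnitaryGroup.conjLocal_conjLocal c v hcδ hδ) A₁)) * FrameTransport.frameConj F E c v (2 + 2) hJ₂D (antidiagonal_over_eq_map F E 2) Q hQ (toLocalFour F E c v (uMinus (UnitaryGroup.LocalRing E v) (UnitaryGroup.conjLocal E c v) (UnitaryGroup.conjLocal_conjLocal c v hcδ hδ) (Pi.single w₁ ζ₁))) * g) := by
    intro ζ₁ ζ₂ g
    rw [frameConj_weylOne_mul_uMinus_of_pair F E c hcδ hδ v hJ₂D Q hQ (Ne.symm hne) hw' A₂ A₁ hA₂ hA₁]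
    simp only [Pi.add_apply, Pi.single_eq_same, Pi.single_eq_of_ne hne, Pi.single_eq_of_ne (Ne.symm hne), add_zero, zero_add]
  have hTAre := re_apply_eq_integral_norm μF hFa hTA
  have hTAnn : ∀ g, 0 ≤ RCLike.re (TA g) := fun g => by rw [hTAre]; exact integral_nonneg fun y => norm_nonneg _
  have hTB₂re : ∀ g, RCLike.re (TB₂ g) = ∫ ζ, RCLike.re (TA (FrameTransport.frameConj F E c v (2 + 2) hJ₂D (antidiagonal_over_eq_map F E 2) Q hQ (toLocalFour F E c v (leviElt (UnitaryGroup.LocalRing E v) (UnitaryGroup.conjLocal E c v) (UnitaryGroup.conjLocal_conjLocal c v hcδ hδ) A₂)) * FrameTransport.frameConj F E c v (2 + 2) hJ₂D (antidiagonal_over_eq_map F E 2) Q hQ (toLocalFour F E c v (uMinus (UnitaryGroup.LocalRing E v) (UnitaryGroup.conjLocal E c v) (UnitaryGroup.conjLocal_conjLocal c v hcδ hδ) (Pi.single w₂ ζ))) * g)) ∂μ₂ := fun g => by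
    rw [hTB₂]; exact (integral_re (hIB2 g)).symm
  have hTBre : ∀ g, RCLike.re (TB g) = ∫ ζ, RCLike.re (TB₂ (FrameTransport.frameConj F E c v (2 + 2) hJ₂D (antidiagonal_over_eq_map F E 2) Q hQ (toLocalFour F E c v (leviElt (UnitaryGroup.LocalRing E v) (UnitaryGroup.conjLocal E c v) (UnitaryGroup.conjLocal_conjLocal c v hcδ hδ) A₁)) * FrameTransport.frameConj F E c v (2 + 2) hJ₂D (antidiagonal_over_eq_map F E 2) Q hQ (toLocalFour F E c v (uMinus (UnitaryGroup.LocalRing E v) (UnitaryGroup.conjLocal E c v) (UnitaryGroup.conjLocal_conjLocal c v hcδ hδ) (Pi.single w₁ ζ))) * g)) ∂μ₁ := fun g => by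
    rw [hTB]; exact (integral_re (hIB1 g)).symm
  -- the product integrability of the middle stage (Fubini)
  have hmapR : Measure.map (⇑e₂) (μ₁.prod μ₂) = Measure.map (⇑e₂.toMeasurableEquiv) (μ₁.prod μ₂) := by rw [Homeomorph.toMeasurableEquiv_coe]
  have huM := continuous_frameConj_uMinus F E c hcδ hδ v hJ₂D Q hQ e he
  have hprod : ∀ g' : UnitaryGroup.localPi E c (2 + 2) J₂D v, Integrable (fun p : (w₁.1.adicCompletion E × w₂.1.adicCompletion E) =>
      ∫ y, ‖f₀ (FrameTransport.frameConj F E c v (2 + 2) hJ₂D (antidiagonal_over_eq_map F E 2) Q hQ (toLocalFour F E c v (weylTwo (UnitaryGroup.LocalRing E v) (UnitaryGroup.conjLocal E c v))) * FrameTransport.frameConj F E c v (2 + 2) hJ₂D (antidiagonal_over_eq_map F E 2) Q hQ (toLocalFour F E c v (uLongTwo (UnitaryGroup.LocalRing E v) (UnitaryGroup.conjLocal E c v) (UnitaryGroup.toLocalRing E v y * algebraMap E (UnitaryGroup.LocalRing E v) δ) (conjLocal_coord F E c hcδ v y))) * (FrameTransport.frameConj F E c v (2 + 2) hJ₂D (antidiagonal_over_eq_map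 F E 2) Q hQ (toLocalFour F E c v (leviElt (UnitaryGroup.LocalRing E v) (UnitaryGroup.conjLocal E c v) (UnitaryGroup.conjLocal_conjLocal c v hcδ hδ) A₂)) * FrameTransport.frameConj F E c v (2 + 2) hJ₂D (antidiagonal_over_eq_map F E 2) Q hQ (toLocalFour F E c v (uMinus (UnitaryGroup.LocalRing E v) (UnitaryGroup.conjLocal E c v) (UnitaryGroup.conjLocal_conjLocal c v hcδ hδ) (Pi.single w₂ p.2))) * (FrameTransport.frameConj F E c v (2 + 2) hJ₂D (antidiagonal_over_eq_map F E 2) Q hQ (toLocalFour F E c v (leviElt (UnitaryGroup.LocalRing E v) (UnitaryGroup.conjLocal E c v) (UnitaryGroup.conjLocal_conjLocal c v hcδ hδ) A₁)) * FrameTransport.frameConj F E c v (2 + 2) hJ₂D (antidiagonal_over_eq_map F E 2) Q hQ (toLocalFour F E c v (uMinus (UnitaryGroup.LocalRing E v) (UnitaryGroup.conjLocal E c v) (UnitaryGroup.conjLocal_conjLocal c v hcδ hδ) (Pi.single w₁ p.1))) * g')))‖ ∂μF) (μ₁.prod μ₂) := by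
    intro g'
    have hG : Continuous fun q : (w₁.1.adicCompletion E × w₂.1.adicCompletion E) × v.adicCompletion F =>
        ‖f₀ (FrameTransport.frameConj F E c v (2 + 2) hJ₂D (antidiagonal_over_eq_map F E 2) Q hQ (toLocalFour F E c v (weylTwo (UnitaryGroup.LocalRing E v) (UnitaryGroup.conjLocal E c v))) * FrameTransport.frameConj F E c v (2 + 2) hJ₂D (antidiagonal_over_eq_map F E 2) Q hQ (toLocalFour F E c v (uLongTwo (UnitaryGroup.LocalRing E v) (UnitaryGroup.conjLocal E c v) (UnitaryGroup.toLocalRing E v q.2 * algebraMap E (UnitaryGroup.LocalRing E v) δ) (conjLocal_coord F E c hcδ v q.2))) * (FrameTransport.frameConj F E c v (2 + 2) hJ₂D (antidiagonal_over_eq_map F E 2) Q hQ (toLocalFour F E c v (leviElt (UnitaryGroup.LocalRing E v) (UnitaryGroup.conjLocal E c v) (UnitaryGroup.conjLocal_conjLocal c v hcδ hδ) A₂)) * FrameTransport.frameConj F E c v (2 + 2) hJ₂D (antidiagonal_over_eq_map F E 2) Q hQ (toLocalFour F E c v (uMinus (UnitaryGroup.LocalRing E v) (UnitaryGroup.conjLocal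 E c v) (UnitaryGroup.conjLocal_conjLocal c v hcδ hδ) (Pi.single w₂ q.1.2))) * (FrameTransport.frameConj F E c v (2 + 2) hJ₂D (antidiagonal_over_eq_map F E 2) Q hQ (toLocalFour F E c v (leviElt (UnitaryGroup.LocalRing E v) (UnitaryGroup.conjLocal E c v) (UnitaryGroup.conjLocal_conjLocal c v hcδ hδ) A₁)) * FrameTransport.frameConj F E c v (2 + 2) hJ₂D (antidiagonal_over_eq_map F E 2) Q hQ (toLocalFour F E c v (uMinus (UnitaryGroup.LocalRing E v) (UnitaryGroup.conjLocal E c v) (UnitaryGroup.conjLocal_conjLocal c v hcδ hδ) (Pi.single w₁ q.1.1))) * g')))‖ := by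
      have h1 : Continuous fun q : (w₁.1.adicCompletion E × w₂.1.adicCompletion E) × v.adicCompletion F => FrameTransport.frameConj F E c v (2 + 2) hJ₂D (antidiagonal_over_eq_map F E 2) Q hQ (toLocalFour F E c v (uLongTwo (UnitaryGroup.LocalRing E v) (UnitaryGroup.conjLocal E c v) (UnitaryGroup.toLocalRing E v q.2 * algebraMap E (UnitaryGroup.LocalRing E v) δ) (conjLocal_coord F E c hcδ v q.2))) := huA.comp continuous_snd
      have h2 : Continuous fun q : (w₁.1.adicCompletion E × w₂.1.adicCompletion E) × v.adicCompletion F => FrameTransport.frameConj F E c v (2 + 2) hJ₂D (antidiagonal_over_eq_map F E 2) Q hQ (toLocalFour F E c v (uMinus (UnitaryGroup.LocalRing E v) (UnitaryGroup.conjLocal E c v) (UnitaryGroup.conjLocal_conjLocal c v hcδ hδ) (Pi.single w₂ q.1.2))) := huB2.1.comp (continuous_snd.comp continuous_fst)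
      have h3 : Continuous fun q : (w₁.1.adicCompletion E × w₂.1.adicCompletion E) × v.adicCompletion F => FrameTransport.frameConj F E c v (2 + 2) hJ₂D (antidiagonal_over_eq_map F E 2) Q hQ (toLocalFour F E c v (uMinus (UnitaryGroup.LocalRing E v) (UnitaryGroup.conjLocal E c v) (UnitaryGroup.conjLocal_conjLocal c v hcδ hδ) (Pi.single w₁ q.1.1))) := huB1.1.comp (continuous_fst.comp continuous_fst)
      exact ((continuous_of_isSmooth F E c v 2 hsm₀).comp
        ((continuous_const.fun_mul h1).fun_mul ((continuous_const.fun_mul h2).fun_mul ((continuous_const.fun_mul h3).fun_mul continuous_const)))).norm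
    refine (integrable_prod_iff (hG.stronglyMeasurable.integral_prod_right'.aestronglyMeasurable)).2 ⟨Filter.Eventually.of_forall fun ζ₁ => ?_, ?_⟩
    · have h := (hIB2 (FrameTransport.frameConj F E c v (2 + 2) hJ₂D (antidiagonal_over_eq_map F E 2) Q hQ (toLocalFour F E c v (leviElt (UnitaryGroup.LocalRing E v) (UnitaryGroup.conjLocal E c v) (UnitaryGroup.conjLocal_conjLocal c v hcδ hδ) A₁)) * FrameTransport.frameConj F E c v (2 + 2) hJ₂D (antidiagonal_over_eq_map F E 2) Q hQ (toLocalFour F E c v (uMinus (UnitaryGroup.LocalRing E v) (UnitaryGroup.conjLocal E c v) (UnitaryGroup.conjLocal_conjLocal c v hcδ hδ) (Pi.single w₁ ζ₁))) * g')).re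
      refine h.congr (Filter.Eventually.of_forall fun ζ₂ => ?_)
      simp only [hTAre]
    · have h := (hIB1 g').re
      refine h.congr (Filter.Eventually.of_forall fun ζ₁ => ?_)
      simp only [hTB₂re]
      refine integral_congr_ae (Filter.Eventually.of_forall fun ζ₂ => ?_)
      simp only []
      rw [Real.norm_of_nonneg (integral_nonneg fun y => norm_nonneg _), ← hTAre]
  refine ⟨?_, fun g => (hIA g).re.congr (ae_of_all _ fun y => by simp only [hFa, RCLike.re_to_complex, Complex.ofReal_re]), fun g' => ?_, ?_⟩
  · -- measurability: the integrand is continuous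
    have h1 : Continuous fun p : v.adicCompletion F × (UnitaryGroup.LocalRing E v × v.adicCompletion F) => FrameTransport.frameConj F E c v (2 + 2) hJ₂D (antidiagonal_over_eq_map F E 2) Q hQ (toLocalFour F E c v (uLongTwo (UnitaryGroup.LocalRing E v) (UnitaryGroup.conjLocal E c v) (UnitaryGroup.toLocalRing E v p.2.2 * algebraMap E (UnitaryGroup.LocalRing E v) δ) (conjLocal_coord F E c hcδ v p.2.2))) :=
      huA.comp (continuous_snd.comp continuous_snd)
    have h2 : Continuous fun p : v.adicCompletion F × (UnitaryGroup.LocalRing E v × v.adicCompletion F) => FrameTransport.frameConj F E c v (2 + 2) hJ₂D (antidiagonal_over_eq_map F E 2) Q hQ (toLocalFour F E c v (uMinus (UnitaryGroup.LocalRing E v) (UnitaryGroup.conjLocal E c v) (UnitaryGroup.conjLocal_conjLocal c v hcδ hδ) p.2.1)) :=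
      huM.comp (continuous_fst.comp continuous_snd)
    have h3 : Continuous fun p : v.adicCompletion F × (UnitaryGroup.LocalRing E v × v.adicCompletion F) => FrameTransport.frameConj F E c v (2 + 2) hJ₂D (antidiagonal_over_eq_map F E 2) Q hQ (toLocalFour F E c v (uLongTwo (UnitaryGroup.LocalRing E v) (UnitaryGroup.conjLocal E c v) (UnitaryGroup.toLocalRing E v p.1 * algebraMap E (UnitaryGroup.LocalRing E v) δ) (conjLocal_coord F E c hcδ v p.1))) :=
      huA.comp continuous_fst
    have hcont : Continuous fun p : v.adicCompletion F × (UnitaryGroup.LocalRing E v × v.adicCompletion F) =>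
        FrameTransport.frameConj F E c v (2 + 2) hJ₂D (antidiagonal_over_eq_map F E 2) Q hQ (toLocalFour F E c v (weylTwo (UnitaryGroup.LocalRing E v) (UnitaryGroup.conjLocal E c v))) * FrameTransport.frameConj F E c v (2 + 2) hJ₂D (antidiagonal_over_eq_map F E 2) Q hQ (toLocalFour F E c v (uLongTwo (UnitaryGroup.LocalRing E v) (UnitaryGroup.conjLocal E c v) (UnitaryGroup.toLocalRing E v p.2.2 * algebraMap E (UnitaryGroup.LocalRing E v) δ) (conjLocal_coord F E c hcδ v p.2.2))) *
          (FrameTransport.frameConj F E c v (2 + 2) hJ₂D (antidiagonal_over_eq_map F E 2) Q hQ (toLocalFour F E c v (weylOne (UnitaryGroup.LocalRing E v) (UnitaryGroup.conjLocal E c v))) * FrameTransport.frameConj F E c v (2 + 2) hJ₂D (antidiagonal_over_eq_map F E 2) Q hQ (toLocalFour F E c v (uMinus (UnitaryGroup.LocalRing E v) (UnitaryGroup.conjLocal E c v) (UnitaryGroup.conjLocal_conjLocal c v hcδ hδ) p.2.1)) *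
            (FrameTransport.frameConj F E c v (2 + 2) hJ₂D (antidiagonal_over_eq_map F E 2) Q hQ (toLocalFour F E c v (weylTwo (UnitaryGroup.LocalRing E v) (UnitaryGroup.conjLocal E c v))) * FrameTransport.frameConj F E c v (2 + 2) hJ₂D (antidiagonal_over_eq_map F E 2) Q hQ (toLocalFour F E c v (uLongTwo (UnitaryGroup.LocalRing E v) (UnitaryGroup.conjLocal E c v) (UnitaryGroup.toLocalRing E v p.1 * algebraMap E (UnitaryGroup.LocalRing E v) δ) (conjLocal_coord F E c hcδ v p.1))) * h)) :=
      (continuous_const.fun_mul h1).fun_mul ((continuous_const.fun_mul h2).fun_mul ((continuous_const.fun_mul h3).fun_mul continuous_const))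
    exact ((continuous_of_isSmooth F E c v 2 hsm₀).comp hcont).aestronglyMeasurable
  · -- hI2 through `e₂` and Fubini
    refine (integrable_map_equiv e₂.toMeasurableEquiv _).2 ?_
    have hfun : (fun z : UnitaryGroup.LocalRing E v => ∫ y, ‖f₀ (FrameTransport.frameConj F E c v (2 + 2) hJ₂D (antidiagonal_over_eq_map F E 2) Q hQ (toLocalFour F E c v (weylTwo (UnitaryGroup.LocalRing E v) (UnitaryGroup.conjLocal E c v))) * FrameTransport.frameConj F E c v (2 + 2) hJ₂D (antidiagonal_over_eq_map F E 2) Q hQ (toLocalFour F E c v (uLongTwo (UnitaryGroup.LocalRing E v) (UnitaryGroup.conjLocal E c v) (UnitaryGroup.toLocalRing E v y * algebraMap E (UnitaryGroup.LocalRing E v) δ) (conjLocal_coord F E c hcδ v y))) *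
          (FrameTransport.frameConj F E c v (2 + 2) hJ₂D (antidiagonal_over_eq_map F E 2) Q hQ (toLocalFour F E c v (weylOne (UnitaryGroup.LocalRing E v) (UnitaryGroup.conjLocal E c v))) * FrameTransport.frameConj F E c v (2 + 2) hJ₂D (antidiagonal_over_eq_map F E 2) Q hQ (toLocalFour F E c v (uMinus (UnitaryGroup.LocalRing E v) (UnitaryGroup.conjLocal E c v) (UnitaryGroup.conjLocal_conjLocal c v hcδ hδ) z)) * g'))‖ ∂μF) ∘ e₂.toMeasurableEquiv = fun p : (w₁.1.adicCompletion E × w₂.1.adicCompletion E) =>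
        ∫ y, ‖f₀ (FrameTransport.frameConj F E c v (2 + 2) hJ₂D (antidiagonal_over_eq_map F E 2) Q hQ (toLocalFour F E c v (weylTwo (UnitaryGroup.LocalRing E v) (UnitaryGroup.conjLocal E c v))) * FrameTransport.frameConj F E c v (2 + 2) hJ₂D (antidiagonal_over_eq_map F E 2) Q hQ (toLocalFour F E c v (uLongTwo (UnitaryGroup.LocalRing E v) (UnitaryGroup.conjLocal E c v) (UnitaryGroup.toLocalRing E v y * algebraMap E (UnitaryGroup.LocalRing E v) δ) (conjLocal_coord F E c hcδ v y))) * (FrameTransport.frameConj F E c v (2 + 2) hJ₂D (antidiagonal_over_eq_map F E 2) Q hQ (toLocalFour F E c v (leviElt (UnitaryGroup.LocalRing E v) (UnitaryGroup.conjLocal E c v) (UnitaryGroup.conjLocal_conjLocal c v hcδ hδ) A₂)) * FrameTransport.frameConj F E c v (2 + 2) hJ₂D (antidiagonal_over_eq_map F E 2) Q hQ (toLocalFour F E c v (uMinus (UnitaryGroup.LocalRing E v) (UnitaryGroup.conjLocal E c v) (UnitaryGroup.conjLocal_conjLocal c v hcδ hδ) (Pi.single w₂ p.2))) * (FrameTransport.frameConj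 F E c v (2 + 2) hJ₂D (antidiagonal_over_eq_map F E 2) Q hQ (toLocalFour F E c v (leviElt (UnitaryGroup.LocalRing E v) (UnitaryGroup.conjLocal E c v) (UnitaryGroup.conjLocal_conjLocal c v hcδ hδ) A₁)) * FrameTransport.frameConj F E c v (2 + 2) hJ₂D (antidiagonal_over_eq_map F E 2) Q hQ (toLocalFour F E c v (uMinus (UnitaryGroup.LocalRing E v) (UnitaryGroup.conjLocal E c v) (UnitaryGroup.conjLocal_conjLocal c v hcδ hδ) (Pi.single w₁ p.1))) * g')))‖ ∂μF := by
      funext p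
      simp only [Function.comp_apply, Homeomorph.toMeasurableEquiv_coe, he₂ p.1 p.2, hmid]
    rw [hfun]
    exact hprod g'
  · -- hI3 through `e₂` and Fubini
    have hmapint : ∀ x : v.adicCompletion F, ∫ z, ∫ y, ‖f₀ (FrameTransport.frameConj F E c v (2 + 2) hJ₂D (antidiagonal_over_eq_map F E 2) Q hQ (toLocalFour F E c v (weylTwo (UnitaryGroup.LocalRing E v) (UnitaryGroup.conjLocal E c v))) * FrameTransport.frameConj F E c v (2 + 2) hJ₂D (antidiagonal_over_eq_map F E 2) Q hQ (toLocalFour F E c v (uLongTwo (UnitaryGroup.LocalRing E v) (UnitaryGroup.conjLocal E c v) (UnitaryGroup.toLocalRing E v y * algebraMap E (UnitaryGroup.LocalRing E v) δ) (conjLocal_coord F E c hcδ v y))) *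
          (FrameTransport.frameConj F E c v (2 + 2) hJ₂D (antidiagonal_over_eq_map F E 2) Q hQ (toLocalFour F E c v (weylOne (UnitaryGroup.LocalRing E v) (UnitaryGroup.conjLocal E c v))) * FrameTransport.frameConj F E c v (2 + 2) hJ₂D (antidiagonal_over_eq_map F E 2) Q hQ (toLocalFour F E c v (uMinus (UnitaryGroup.LocalRing E v) (UnitaryGroup.conjLocal E c v) (UnitaryGroup.conjLocal_conjLocal c v hcδ hδ) z)) *
            (FrameTransport.frameConj F E c v (2 + 2) hJ₂D (antidiagonal_over_eq_map F E 2) Q hQ (toLocalFour F E c v (weylTwo (UnitaryGroup.LocalRing E v) (UnitaryGroup.conjLocal E c v))) * FrameTransport.frameConj F E c v (2 + 2) hJ₂D (antidiagonal_over_eq_map F E 2) Q hQ (toLocalFour F E c v (uLongTwo (UnitaryGroup.LocalRing E v) (UnitaryGroup.conjLocal E c v) (UnitaryGroup.toLocalRing E v x * algebraMap E (UnitaryGroup.LocalRing E v) δ) (conjLocal_coord F E c hcδ v x))) * h)))‖ ∂μF ∂(Measure.map (⇑e₂) (μ₁.prod μ₂)) =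
        RCLike.re (TB (FrameTransport.frameConj F E c v (2 + 2) hJ₂D (antidiagonal_over_eq_map F E 2) Q hQ (toLocalFour F E c v (weylTwo (UnitaryGroup.LocalRing E v) (UnitaryGroup.conjLocal E c v))) * FrameTransport.frameConj F E c v (2 + 2) hJ₂D (antidiagonal_over_eq_map F E 2) Q hQ (toLocalFour F E c v (uLongTwo (UnitaryGroup.LocalRing E v) (UnitaryGroup.conjLocal E c v) (UnitaryGroup.toLocalRing E v x * algebraMap E (UnitaryGroup.LocalRing E v) δ) (conjLocal_coord F E c hcδ v x))) * h)) := fun x => by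
      rw [hmapR, integral_map_equiv]
      have hpt : (fun p : (w₁.1.adicCompletion E × w₂.1.adicCompletion E) => ∫ y, ‖f₀ (FrameTransport.frameConj F E c v (2 + 2) hJ₂D (antidiagonal_over_eq_map F E 2) Q hQ (toLocalFour F E c v (weylTwo (UnitaryGroup.LocalRing E v) (UnitaryGroup.conjLocal E c v))) * FrameTransport.frameConj F E c v (2 + 2) hJ₂D (antidiagonal_over_eq_map F E 2) Q hQ (toLocalFour F E c v (uLongTwo (UnitaryGroup.LocalRing E v) (UnitaryGroup.conjLocal E c v) (UnitaryGroup.toLocalRing E v y * algebraMap E (UnitaryGroup.LocalRing E v) δ) (conjLocal_coord F E c hcδ v y))) *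
          (FrameTransport.frameConj F E c v (2 + 2) hJ₂D (antidiagonal_over_eq_map F E 2) Q hQ (toLocalFour F E c v (weylOne (UnitaryGroup.LocalRing E v) (UnitaryGroup.conjLocal E c v))) * FrameTransport.frameConj F E c v (2 + 2) hJ₂D (antidiagonal_over_eq_map F E 2) Q hQ (toLocalFour F E c v (uMinus (UnitaryGroup.LocalRing E v) (UnitaryGroup.conjLocal E c v) (UnitaryGroup.conjLocal_conjLocal c v hcδ hδ) (e₂.toMeasurableEquiv p))) *
            (FrameTransport.frameConj F E c v (2 + 2) hJ₂D (antidiagonal_over_eq_map F E 2) Q hQ (toLocalFour F E c v (weylTwo (UnitaryGroup.LocalRing E v) (UnitaryGroup.conjLocal E c v))) * FrameTransport.frameConj F E c v (2 + 2) hJ₂D (antidiagonal_over_eq_map F E 2) Q hQ (toLocalFour F E c v (uLongTwo (UnitaryGroup.LocalRing E v) (UnitaryGroup.conjLocal E c v) (UnitaryGroup.toLocalRing E v x * algebraMap E (UnitaryGroup.LocalRing E v) δ) (conjLocal_coord F E c hcδ v x))) * h)))‖ ∂μF) = fun p : (w₁.1.adicCompletion E × w₂.1.adicCompletion E) =>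
          ∫ y, ‖f₀ (FrameTransport.frameConj F E c v (2 + 2) hJ₂D (antidiagonal_over_eq_map F E 2) Q hQ (toLocalFour F E c v (weylTwo (UnitaryGroup.LocalRing E v) (UnitaryGroup.conjLocal E c v))) * FrameTransport.frameConj F E c v (2 + 2) hJ₂D (antidiagonal_over_eq_map F E 2) Q hQ (toLocalFour F E c v (uLongTwo (UnitaryGroup.LocalRing E v) (UnitaryGroup.conjLocal E c v) (UnitaryGroup.toLocalRing E v y * algebraMap E (UnitaryGroup.LocalRing E v) δ) (conjLocal_coord F E c hcδ v y))) * (FrameTransport.frameConj F E c v (2 + 2) hJ₂D (antidiagonal_over_eq_map F E 2) Q hQ (toLocalFour F E c v (leviElt (UnitaryGroup.LocalRing E v) (UnitaryGroup.conjLocal E c v) (UnitaryGroup.conjLocal_conjLocal c v hcδ hδ) A₂)) * FrameTransport.frameConj F E c v (2 + 2) hJ₂D (antidiagonal_over_eq_map F E 2) Q hQ (toLocalFour F E c v (uMinus (UnitaryGroup.LocalRing E v) (UnitaryGroup.conjLocal E c v) (UnitaryGroup.conjLocal_conjLocal c v hcδ hδ) (Pi.single w₂ p.2))) * (FrameTransport.frameConj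 F E c v (2 + 2) hJ₂D (antidiagonal_over_eq_map F E 2) Q hQ (toLocalFour F E c v (leviElt (UnitaryGroup.LocalRing E v) (UnitaryGroup.conjLocal E c v) (UnitaryGroup.conjLocal_conjLocal c v hcδ hδ) A₁)) * FrameTransport.frameConj F E c v (2 + 2) hJ₂D (antidiagonal_over_eq_map F E 2) Q hQ (toLocalFour F E c v (uMinus (UnitaryGroup.LocalRing E v) (UnitaryGroup.conjLocal E c v) (UnitaryGroup.conjLocal_conjLocal c v hcδ hδ) (Pi.single w₁ p.1))) *
            (FrameTransport.frameConj F E c v (2 + 2) hJ₂D (antidiagonal_over_eq_map F E 2) Q hQ (toLocalFour F E c v (weylTwo (UnitaryGroup.LocalRing E v) (UnitaryGroup.conjLocal E c v))) * FrameTransport.frameConj F E c v (2 + 2) hJ₂D (antidiagonal_over_eq_map F E 2) Q hQ (toLocalFour F E c v (uLongTwo (UnitaryGroup.LocalRing E v) (UnitaryGroup.conjLocal E c v) (UnitaryGroup.toLocalRing E v x * algebraMap E (UnitaryGroup.LocalRing E v) δ) (conjLocal_coord F E c hcδ v x))) * h))))‖ ∂μF := by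
        funext p
        simp only [Homeomorph.toMeasurableEquiv_coe, he₂ p.1 p.2, hmid]
      rw [hpt, integral_prod _ (hprod _), hTBre]
      refine integral_congr_ae (Filter.Eventually.of_forall fun ζ₁ => ?_)
      simp only [hTB₂re, hTAre]
    have hfun : (fun x : v.adicCompletion F => ∫ z, ∫ y, ‖f₀ (FrameTransport.frameConj F E c v (2 + 2) hJ₂D (antidiagonal_over_eq_map F E 2) Q hQ (toLocalFour F E c v (weylTwo (UnitaryGroup.LocalRing E v) (UnitaryGroup.conjLocal E c v))) * FrameTransport.frameConj F E c v (2 + 2) hJ₂D (antidiagonal_over_eq_map F E 2) Q hQ (toLocalFour F E c v (uLongTwo (UnitaryGroup.LocalRing E v) (UnitaryGroup.conjLocal E c v) (UnitaryGroup.toLocalRing E v y * algebraMap E (UnitaryGroup.LocalRing E v) δ) (conjLocal_coord F E c hcδ v y))) *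
          (FrameTransport.frameConj F E c v (2 + 2) hJ₂D (antidiagonal_over_eq_map F E 2) Q hQ (toLocalFour F E c v (weylOne (UnitaryGroup.LocalRing E v) (UnitaryGroup.conjLocal E c v))) * FrameTransport.frameConj F E c v (2 + 2) hJ₂D (antidiagonal_over_eq_map F E 2) Q hQ (toLocalFour F E c v (uMinus (UnitaryGroup.LocalRing E v) (UnitaryGroup.conjLocal E c v) (UnitaryGroup.conjLocal_conjLocal c v hcδ hδ) z)) *
            (FrameTransport.frameConj F E c v (2 + 2) hJ₂D (antidiagonal_over_eq_map F E 2) Q hQ (toLocalFour F E c v (weylTwo (UnitaryGroup.LocalRing E v) (UnitaryGroup.conjLocal E c v))) * FrameTransport.frameConj F E c v (2 + 2) hJ₂D (antidiagonal_over_eq_map F E 2) Q hQ (toLocalFour F E c v (uLongTwo (UnitaryGroup.LocalRing E v) (UnitaryGroup.conjLocal E c v) (UnitaryGroup.toLocalRing E v x * algebraMap E (UnitaryGroup.LocalRing E v) δ) (conjLocal_coord F E c hcδ v x))) * h)))‖ ∂μF ∂(Measure.map (⇑e₂) (μ₁.prod μ₂))) =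
        fun x => RCLike.re (TB (FrameTransport.frameConj F E c v (2 + 2) hJ₂D (antidiagonal_over_eq_map F E 2) Q hQ (toLocalFour F E c v (weylTwo (UnitaryGroup.LocalRing E v) (UnitaryGroup.conjLocal E c v))) * FrameTransport.frameConj F E c v (2 + 2) hJ₂D (antidiagonal_over_eq_map F E 2) Q hQ (toLocalFour F E c v (uLongTwo (UnitaryGroup.LocalRing E v) (UnitaryGroup.conjLocal E c v) (UnitaryGroup.toLocalRing E v x * algebraMap E (UnitaryGroup.LocalRing E v) δ) (conjLocal_coord F E c hcδ v x))) * h)) := funext hmapint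
    rw [hfun]
    exact (hIC h).re

end Summit.HodgeConjecture.HodgeConjecture.Cruxes.HLiu418.K2LiuA7NormalisedRegularityMajorantSplit

end
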